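import Summits.Ventures.Crystal3D.Theses.StickyWulffConstant
import Literature.MathematicalPhysics.StatisticalMechanics.BarlowCoordination
import HarnessLib

/-!
# Layer decomposition of clusters in a Barlow stacking (stub `stub_layerDecomposition` of the
# crux `StackingLiminf`, stmt-Ventures-19145, line `LayerChain`)

Route `StickyWulffConstant` of the venture `Summits/Ventures/Crystal3D` (cell `crystal3d-full`).
STEP 1 of the planner's line `LayerChain` (cf-p1 gen 10; item evidence `LayerChain.lean`), in the
def-free form registered on the item: every injective `N`-configuration `x` inside
`barlowStacking 1 √(2/3) σ` (`σ` a Hägg sequence) is a finitely supported LAYER CHAIN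
`X : ℤ → Finset (ℤ × ℤ)` — `X k` = the in-layer labels `(i, j)` of the balls in layer `k`
(`barlowPos 1 √(2/3) σ k i j`) — with `∑ |X k| = N`, and its contact number is the explicit integer
chain functional: in-layer pairs `(p, q) ∈ X k × X k` with `q − p ∈ {(1,0), (0,1), (−1,1)}` (one
representative per `±` pair of the six in-layer offsets) plus, across the gap `k → k+1`, the pairs
with difference in `{(0,0), (−1,0), (0,−1)}`, read forward (`X k × X (k+1)`) if `σ k = 1` and
backward (`X (k+1) × X k`) if `σ k = −1`.

Proof: bookkeeping over the shell theorem `dist_barlowPos_eq_iff` (ordered touching pairs =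
in-layer ⊔ upward ⊔ downward; downward = upward swapped; in-layer pairs through the labels have
difference in `sixOffsets = posDirs ∪ (−posDirs)`; upward pairs are the gap pairs by the letter).
WHAT THIS IS NOT: any inequality; nothing about which stacking is optimal; rung F-C1 not moved.
-/

noncomputable section

namespace Summit.Ventures.Crystal3D.Theorems

open Finset
open Literature.MathematicalPhysics.StatisticalMechanics (barlowPos barlowStacking IsHaggSeq
  sixOffsets threeOffsets dist_barlowPos_eq_iff)

/-- In the triangular label lattice, the ordered pairs of a finite set with difference among the
six neighbour offsets are twice the pairs with difference in `{(1,0), (0,1), (−1,1)}` (swap the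
other three). -/
theorem card_filter_sub_mem_sixOffsets (S : Finset (ℤ × ℤ)) :
    ((S ×ˢ S).filter fun pq : (ℤ × ℤ) × (ℤ × ℤ) => pq.2 - pq.1 ∈ sixOffsets).card =
      2 * ((S ×ˢ S).filter fun pq : (ℤ × ℤ) × (ℤ × ℤ) =>
        pq.2 - pq.1 ∈ ({(1, 0), (0, 1), (-1, 1)} : Finset (ℤ × ℤ))).card := by
  classical
  set A := (S ×ˢ S).filter fun pq : (ℤ × ℤ) × (ℤ × ℤ) => pq.2 - pq.1 ∈ sixOffsets with hA
  set Pos := (S ×ˢ S).filter fun pq : (ℤ × ℤ) × (ℤ × ℤ) =>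
    pq.2 - pq.1 ∈ ({(1, 0), (0, 1), (-1, 1)} : Finset (ℤ × ℤ)) with hPos
  set Neg := (S ×ˢ S).filter fun pq : (ℤ × ℤ) × (ℤ × ℤ) =>
    pq.2 - pq.1 ∈ ({(-1, 0), (0, -1), (1, -1)} : Finset (ℤ × ℤ)) with hNeg
  -- membership in the three literal sets, on components
  have hsix : ∀ u v : ℤ, ((u, v) ∈ sixOffsets ↔
      (u = 1 ∧ v = 0) ∨ (u = -1 ∧ v = 0) ∨ (u = 0 ∧ v = 1) ∨ (u = 0 ∧ v = -1) ∨
        (u = 1 ∧ v = -1) ∨ (u = -1 ∧ v = 1)) := by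
    intro u v; simp only [sixOffsets, Finset.mem_insert, Finset.mem_singleton, Prod.mk.injEq]
  have hpos : ∀ u v : ℤ, ((u, v) ∈ ({(1, 0), (0, 1), (-1, 1)} : Finset (ℤ × ℤ)) ↔
      (u = 1 ∧ v = 0) ∨ (u = 0 ∧ v = 1) ∨ (u = -1 ∧ v = 1)) := by
    intro u v; simp only [Finset.mem_insert, Finset.mem_singleton, Prod.mk.injEq]
  have hneg : ∀ u v : ℤ, ((u, v) ∈ ({(-1, 0), (0, -1), (1, -1)} : Finset (ℤ × ℤ)) ↔
      (u = -1 ∧ v = 0) ∨ (u = 0 ∧ v = -1) ∨ (u = 1 ∧ v = -1)) := by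
    intro u v; simp only [Finset.mem_insert, Finset.mem_singleton, Prod.mk.injEq]
  have e1 : A.filter (fun pq => pq.2 - pq.1 ∈ ({(1, 0), (0, 1), (-1, 1)} : Finset (ℤ × ℤ))) =
      Pos := by
    ext ⟨⟨p1, p2⟩, ⟨q1, q2⟩⟩
    simp only [hA, hPos, mem_filter, mem_product, Prod.mk_sub_mk, hsix, hpos]
    constructor
    · rintro ⟨⟨hS, -⟩, hp⟩; exact ⟨hS, hp⟩
    · rintro ⟨hS, hp⟩; exact ⟨⟨hS, by omega⟩, hp⟩
  have e2 : A.filter (fun pq => ¬ pq.2 - pq.1 ∈ ({(1, 0), (0, 1), (-1, 1)} : Finset (ℤ × ℤ))) =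
      Neg := by
    ext ⟨⟨p1, p2⟩, ⟨q1, q2⟩⟩
    simp only [hA, hNeg, mem_filter, mem_product, Prod.mk_sub_mk, hsix, hpos, hneg]
    constructor
    · rintro ⟨⟨hS, h6⟩, hp⟩; exact ⟨hS, by omega⟩
    · rintro ⟨hS, hn⟩; exact ⟨⟨hS, by omega⟩, by omega⟩
  have hsplit := card_filter_add_card_filter_not (s := A)
    (fun pq => pq.2 - pq.1 ∈ ({(1, 0), (0, 1), (-1, 1)} : Finset (ℤ × ℤ)))
  rw [e1, e2] at hsplit
  have hswap : Neg.card = Pos.card := by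
    refine card_nbij' Prod.swap Prod.swap (fun pq hpq => ?_) (fun pq hpq => ?_)
      (fun pq _ => Prod.swap_swap pq) (fun pq _ => Prod.swap_swap pq)
    · obtain ⟨⟨p1, p2⟩, ⟨q1, q2⟩⟩ := pq
      have h := mem_coe.1 hpq
      simp only [hNeg, mem_filter, mem_product, Prod.mk_sub_mk, hneg] at h
      obtain ⟨⟨hpS, hqS⟩, hd⟩ := h
      refine mem_coe.2 ?_
      simp only [hPos, Prod.swap_prod_mk, mem_filter, mem_product, Prod.mk_sub_mk, hpos]
      exact ⟨⟨hqS, hpS⟩, by omega⟩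
    · obtain ⟨⟨p1, p2⟩, ⟨q1, q2⟩⟩ := pq
      have h := mem_coe.1 hpq
      simp only [hPos, mem_filter, mem_product, Prod.mk_sub_mk, hpos] at h
      obtain ⟨⟨hpS, hqS⟩, hd⟩ := h
      refine mem_coe.2 ?_
      simp only [hNeg, Prod.swap_prod_mk, mem_filter, mem_product, Prod.mk_sub_mk, hneg]
      exact ⟨⟨hqS, hpS⟩, by omega⟩
  omega

-- one long bookkeeping proof (three bijections between fibres of the contact pairs and label
-- pairs): the default heartbeat budget is too small for the single declaration
set_option maxHeartbeats 1000000 in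
/-- **Stub `stub_layerDecomposition` (STEP 1 of line `LayerChain`; registered on
stmt-Ventures-19145).** Every injective configuration inside a Barlow stacking is a finitely
supported layer chain on `ℤ²` with the same number of points and the same number of contacts
(in-layer pairs with difference in `{(1,0),(0,1),(−1,1)}`; gap pairs with difference in
`{(0,0),(−1,0),(0,−1)}`, forward if `σ k = 1`, backward otherwise). -/
theorem stub_layerDecomposition :
    ∀ σ : ℤ → ℤ, IsHaggSeq σ → ∀ (N : ℕ) (x : Fin N → EuclideanSpace ℝ (Fin 3)),
      Function.Injective x → (∀ i, x i ∈ barlowStacking 1 (Real.sqrt (2 / 3)) σ) →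
      ∃ (K : Finset ℤ) (X : ℤ → Finset (ℤ × ℤ)), (∀ k, k ∉ K → X k = ∅) ∧
        (∑ k ∈ K, (X k).card) = N ∧
        numContacts x =
          (∑ k ∈ K, ((X k ×ˢ X k).filter fun pq : (ℤ × ℤ) × (ℤ × ℤ) =>
              pq.2 - pq.1 ∈ ({(1, 0), (0, 1), (-1, 1)} : Finset (ℤ × ℤ))).card) +
          ∑ k ∈ K, (if σ k = 1 then
              ((X k ×ˢ X (k + 1)).filter fun pq : (ℤ × ℤ) × (ℤ × ℤ) =>
                pq.2 - pq.1 ∈ ({(0, 0), (-1, 0), (0, -1)} : Finset (ℤ × ℤ))).card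
            else
              ((X (k + 1) ×ˢ X k).filter fun pq : (ℤ × ℤ) × (ℤ × ℤ) =>
                pq.2 - pq.1 ∈ ({(0, 0), (-1, 0), (0, -1)} : Finset (ℤ × ℤ))).card) := by
  classical
  intro σ hσ N x hx hmem
  have hh : (Real.sqrt (2 / 3)) ^ 2 = 2 / 3 * (1 : ℝ) ^ 2 := by
    rw [Real.sq_sqrt (by norm_num)]; ring
  -- coordinates
  have hcoord : ∀ i, ∃ k a b : ℤ, x i = barlowPos 1 (Real.sqrt (2 / 3)) σ k a b := fun i => hmem i
  choose k a b hc using hcoord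
  have hcoord_inj : ∀ i j, k i = k j → a i = a j → b i = b j → i = j := by
    intro i j h1 h2 h3
    apply hx; rw [hc i, hc j, h1, h2, h3]
  have hshell : ∀ i j, dist (x i) (x j) = 1 ↔
      (k j = k i ∧ (a i - a j, b i - b j) ∈ sixOffsets) ∨
      (k j = k i + 1 ∧ (a i - a j, b i - b j) ∈ threeOffsets (-σ (k i))) ∨
      (k j = k i - 1 ∧ (a i - a j, b i - b j) ∈ threeOffsets (σ (k i - 1))) := by
    intro i j; rw [hc i, hc j]; exact dist_barlowPos_eq_iff hσ one_pos hh _ _ _ _ _ _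
  -- membership characterisations of the literal offset sets
  have hsix : ∀ u v : ℤ, ((u, v) ∈ sixOffsets ↔
      (u = 1 ∧ v = 0) ∨ (u = -1 ∧ v = 0) ∨ (u = 0 ∧ v = 1) ∨ (u = 0 ∧ v = -1) ∨
        (u = 1 ∧ v = -1) ∨ (u = -1 ∧ v = 1)) := by
    intro u v; simp only [sixOffsets, Finset.mem_insert, Finset.mem_singleton, Prod.mk.injEq]
  have hthree_pos : ∀ u v : ℤ, ((u, v) ∈ threeOffsets 1 ↔
      (u = 0 ∧ v = 0) ∨ (u = -1 ∧ v = 0) ∨ (u = 0 ∧ v = -1)) := by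
    intro u v
    simp only [threeOffsets, if_true, Finset.mem_insert, Finset.mem_singleton, Prod.mk.injEq]
  have hthree_neg : ∀ u v : ℤ, ((u, v) ∈ threeOffsets (-1) ↔
      (u = 0 ∧ v = 0) ∨ (u = 1 ∧ v = 0) ∨ (u = 0 ∧ v = 1)) := by
    intro u v
    simp only [threeOffsets, show (-1 : ℤ) ≠ 1 by decide, if_false, Finset.mem_insert,
      Finset.mem_singleton, Prod.mk.injEq]
  have hfwd : ∀ u v : ℤ, ((u, v) ∈ ({(0, 0), (-1, 0), (0, -1)} : Finset (ℤ × ℤ)) ↔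
      (u = 0 ∧ v = 0) ∨ (u = -1 ∧ v = 0) ∨ (u = 0 ∧ v = -1)) := by
    intro u v; simp only [Finset.mem_insert, Finset.mem_singleton, Prod.mk.injEq]
  -- the chain
  set K : Finset ℤ := univ.image k with hK
  set L : ℤ → Finset (Fin N) := fun κ => univ.filter fun i : Fin N => k i = κ with hL
  set X : ℤ → Finset (ℤ × ℤ) := fun κ => (L κ).image fun i => (a i, b i) with hX
  have hLinj : ∀ κ, Set.InjOn (fun i => (a i, b i)) ↑(L κ) := by
    intro κ i hi j hj heq
    simp only [Prod.mk.injEq] at heq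
    have hki := (mem_filter.1 (mem_coe.1 hi)).2
    have hkj := (mem_filter.1 (mem_coe.1 hj)).2
    exact hcoord_inj i j (hki.trans hkj.symm) heq.1 heq.2
  have hmemX : ∀ κ (p : ℤ × ℤ), p ∈ X κ ↔ ∃ i, k i = κ ∧ (a i, b i) = p := by
    intro κ p
    simp only [hX, hL, mem_image, mem_filter, mem_univ, true_and]
  refine ⟨K, X, ?_, ?_, ?_⟩
  · -- finitely supported
    intro κ hκ
    have : L κ = ∅ := by
      rw [hL, filter_eq_empty_iff]
      intro i _ hki; exact hκ (hki ▸ mem_image_of_mem _ (mem_univ _))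
    simp only [hX, this, image_empty]
  · -- number of points
    have hcardX : ∀ κ, (X κ).card = (L κ).card := fun κ => card_image_of_injOn (hLinj κ)
    simp only [hcardX]
    have := card_eq_sum_card_fiberwise (f := k) (s := (univ : Finset (Fin N))) (t := K)
      fun i _ => mem_image_of_mem _ (mem_univ _)
    rw [card_univ, Fintype.card_fin] at this
    exact this.symm
  · -- number of contacts
    -- ordered touching pairs
    set P : Finset (Fin N × Fin N) :=
      univ.filter fun p => p.1 ≠ p.2 ∧ dist (x p.1) (x p.2) = 1 with hP
    have hPcard : P.card = 2 * numContacts x := by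
      rw [← sum_coordination_eq, hP, card_filter, Fintype.sum_prod_type]
      refine sum_congr rfl fun i _ => ?_
      rw [coordination, contactNeighbors, card_filter]
      refine sum_congr rfl fun j _ => ?_
      by_cases hij : j = i
      · subst hij; simp
      · simp [hij, Ne.symm hij]
    set Pin := P.filter fun p => k p.2 = k p.1 with hPin
    set Pup := P.filter fun p => k p.2 = k p.1 + 1 with hPup
    set Pdn := P.filter fun p => k p.2 = k p.1 - 1 with hPdn
    -- exact three-way split
    have hsplit : P.card = Pin.card + Pup.card + Pdn.card := by
      have h1 : Pin.card + (P.filter fun p => ¬ k p.2 = k p.1).card = P.card :=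
        card_filter_add_card_filter_not (s := P) (fun p => k p.2 = k p.1)
      have h2 := card_filter_add_card_filter_not (s := P.filter fun p => ¬ k p.2 = k p.1)
        (fun p => k p.2 = k p.1 + 1)
      have e1 : (P.filter fun p => ¬ k p.2 = k p.1).filter (fun p => k p.2 = k p.1 + 1) = Pup := by
        ext p; simp only [hPup, mem_filter]; constructor
        · rintro ⟨⟨hp, -⟩, h⟩; exact ⟨hp, h⟩
        · rintro ⟨hp, h⟩; exact ⟨⟨hp, by omega⟩, h⟩
      have e2 : (P.filter fun p => ¬ k p.2 = k p.1).filter (fun p => ¬ k p.2 = k p.1 + 1) =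
          Pdn := by
        ext p; simp only [hPdn, mem_filter]; constructor
        · rintro ⟨⟨hp, hne⟩, hnu⟩
          have hd : dist (x p.1) (x p.2) = 1 := (mem_filter.1 hp).2.2
          rcases (hshell p.1 p.2).1 hd with ⟨h, -⟩ | ⟨h, -⟩ | ⟨h, -⟩
          · exact absurd h hne
          · exact absurd h hnu
          · exact ⟨hp, h⟩
        · rintro ⟨hp, h⟩; exact ⟨⟨hp, by omega⟩, by omega⟩
      rw [e1, e2] at h2
      omega
    have hswap : Pdn.card = Pup.card := by
      refine card_nbij' Prod.swap Prod.swap (fun p hp => ?_) (fun p hp => ?_)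
        (fun p _ => Prod.swap_swap p) (fun p _ => Prod.swap_swap p)
      · obtain ⟨hpP, hk⟩ := mem_filter.1 (mem_coe.1 hp)
        obtain ⟨-, hne, hd⟩ := mem_filter.1 hpP
        refine mem_coe.2 (mem_filter.2 ⟨mem_filter.2 ⟨mem_univ _, ?_, ?_⟩, ?_⟩)
        · exact fun h => hne h.symm
        · rw [Prod.fst_swap, Prod.snd_swap, dist_comm]; exact hd
        · rw [Prod.fst_swap, Prod.snd_swap]; omega
      · obtain ⟨hpP, hk⟩ := mem_filter.1 (mem_coe.1 hp)
        obtain ⟨-, hne, hd⟩ := mem_filter.1 hpP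
        refine mem_coe.2 (mem_filter.2 ⟨mem_filter.2 ⟨mem_univ _, ?_, ?_⟩, ?_⟩)
        · exact fun h => hne h.symm
        · rw [Prod.fst_swap, Prod.snd_swap, dist_comm]; exact hd
        · rw [Prod.fst_swap, Prod.snd_swap]; omega
    -- in-layer pairs, layer by layer
    have hPin_sum : Pin.card = ∑ κ ∈ K, (Pin.filter fun p => k p.1 = κ).card :=
      card_eq_sum_card_fiberwise (f := fun p => k p.1) (s := Pin) (t := K)
        fun p _ => mem_image_of_mem _ (mem_univ _)
    have hin : ∀ κ, (Pin.filter fun p => k p.1 = κ).card =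
        ((X κ ×ˢ X κ).filter fun pq : (ℤ × ℤ) × (ℤ × ℤ) => pq.2 - pq.1 ∈ sixOffsets).card := by
      intro κ
      have himg : (Pin.filter fun p => k p.1 = κ).image
          (fun p : Fin N × Fin N => ((a p.1, b p.1), (a p.2, b p.2))) =
          (X κ ×ˢ X κ).filter fun pq : (ℤ × ℤ) × (ℤ × ℤ) => pq.2 - pq.1 ∈ sixOffsets := by
        ext pq
        obtain ⟨p, q⟩ := pq
        constructor
        · intro h
          obtain ⟨ij, hij, hpq⟩ := mem_image.1 h
          obtain ⟨hPin', hki⟩ := mem_filter.1 hij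
          obtain ⟨hP', hkk⟩ := mem_filter.1 hPin'
          obtain ⟨-, hne, hd⟩ := mem_filter.1 hP'
          simp only [Prod.mk.injEq] at hpq
          obtain ⟨rfl, rfl⟩ := hpq
          refine mem_filter.2 ⟨mem_product.2 ⟨(hmemX κ _).2 ⟨ij.1, hki, rfl⟩,
            (hmemX κ _).2 ⟨ij.2, by omega, rfl⟩⟩, ?_⟩
          rcases (hshell ij.1 ij.2).1 hd with ⟨-, h6⟩ | ⟨h, -⟩ | ⟨h, -⟩
          · rw [Prod.mk_sub_mk, hsix]; rw [hsix] at h6; omega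
          · omega
          · omega
        · intro h
          obtain ⟨hpq, h6⟩ := mem_filter.1 h
          obtain ⟨hp, hq⟩ := mem_product.1 hpq
          obtain ⟨i, hki, rfl⟩ := (hmemX κ p).1 hp
          obtain ⟨j, hkj, rfl⟩ := (hmemX κ q).1 hq
          rw [Prod.mk_sub_mk, hsix] at h6
          have hne : i ≠ j := by rintro rfl; omega
          have hd : dist (x i) (x j) = 1 :=
            (hshell i j).2 (Or.inl ⟨by rw [hki, hkj], by rw [hsix]; omega⟩)
          exact mem_image.2 ⟨(i, j), mem_filter.2 ⟨mem_filter.2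
            ⟨mem_filter.2 ⟨mem_univ _, hne, hd⟩, show k j = k i by rw [hki, hkj]⟩, hki⟩, rfl⟩
      rw [← himg, card_image_of_injOn]
      intro p hp q hq heq
      simp only [Prod.mk.injEq] at heq
      obtain ⟨hp1, hpκ⟩ := mem_filter.1 (mem_coe.1 hp)
      obtain ⟨hq1, hqκ⟩ := mem_filter.1 (mem_coe.1 hq)
      have hkp := (mem_filter.1 hp1).2
      have hkq := (mem_filter.1 hq1).2
      exact Prod.ext (hcoord_inj _ _ (by omega) heq.1.1 heq.1.2)
        (hcoord_inj _ _ (by omega) heq.2.1 heq.2.2)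
    -- upward pairs, layer by layer
    have hPup_sum : Pup.card = ∑ κ ∈ K, (Pup.filter fun p => k p.1 = κ).card :=
      card_eq_sum_card_fiberwise (f := fun p => k p.1) (s := Pup) (t := K)
        fun p _ => mem_image_of_mem _ (mem_univ _)
    have hup : ∀ κ, (Pup.filter fun p => k p.1 = κ).card =
        (if σ κ = 1 then
          ((X κ ×ˢ X (κ + 1)).filter fun pq : (ℤ × ℤ) × (ℤ × ℤ) =>
            pq.2 - pq.1 ∈ ({(0, 0), (-1, 0), (0, -1)} : Finset (ℤ × ℤ))).card
        else
          ((X (κ + 1) ×ˢ X κ).filter fun pq : (ℤ × ℤ) × (ℤ × ℤ) =>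
            pq.2 - pq.1 ∈ ({(0, 0), (-1, 0), (0, -1)} : Finset (ℤ × ℤ))).card) := by
      intro κ
      -- injectivity of both label maps on the fibre
      have hinj1 : Set.InjOn (fun p : Fin N × Fin N => ((a p.1, b p.1), (a p.2, b p.2)))
          ↑(Pup.filter fun p => k p.1 = κ) := by
        intro p hp q hq heq
        simp only [Prod.mk.injEq] at heq
        obtain ⟨hp1, hpκ⟩ := mem_filter.1 (mem_coe.1 hp)
        obtain ⟨hq1, hqκ⟩ := mem_filter.1 (mem_coe.1 hq)
        have hkp := (mem_filter.1 hp1).2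
        have hkq := (mem_filter.1 hq1).2
        exact Prod.ext (hcoord_inj _ _ (by omega) heq.1.1 heq.1.2)
          (hcoord_inj _ _ (by omega) heq.2.1 heq.2.2)
      have hinj2 : Set.InjOn (fun p : Fin N × Fin N => ((a p.2, b p.2), (a p.1, b p.1)))
          ↑(Pup.filter fun p => k p.1 = κ) := by
        intro p hp q hq heq
        simp only [Prod.mk.injEq] at heq
        obtain ⟨hp1, hpκ⟩ := mem_filter.1 (mem_coe.1 hp)
        obtain ⟨hq1, hqκ⟩ := mem_filter.1 (mem_coe.1 hq)
        have hkp := (mem_filter.1 hp1).2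
        have hkq := (mem_filter.1 hq1).2
        exact Prod.ext (hcoord_inj _ _ (by omega) heq.2.1 heq.2.2)
          (hcoord_inj _ _ (by omega) heq.1.1 heq.1.2)
      rcases hσ κ with hσκ | hσκ
      · -- letter `+1`: forward pairs
        rw [if_pos hσκ]
        have himg : (Pup.filter fun p => k p.1 = κ).image
            (fun p : Fin N × Fin N => ((a p.1, b p.1), (a p.2, b p.2))) =
            (X κ ×ˢ X (κ + 1)).filter fun pq : (ℤ × ℤ) × (ℤ × ℤ) =>
              pq.2 - pq.1 ∈ ({(0, 0), (-1, 0), (0, -1)} : Finset (ℤ × ℤ)) := by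
          ext pq
          obtain ⟨p, q⟩ := pq
          constructor
          · intro h
            obtain ⟨ij, hij, hpq⟩ := mem_image.1 h
            obtain ⟨hPup', hki⟩ := mem_filter.1 hij
            obtain ⟨hP', hkk⟩ := mem_filter.1 hPup'
            obtain ⟨-, hne, hd⟩ := mem_filter.1 hP'
            simp only [Prod.mk.injEq] at hpq
            obtain ⟨rfl, rfl⟩ := hpq
            refine mem_filter.2 ⟨mem_product.2 ⟨(hmemX κ _).2 ⟨ij.1, hki, rfl⟩,
              (hmemX (κ + 1) _).2 ⟨ij.2, by omega, rfl⟩⟩, ?_⟩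
            rcases (hshell ij.1 ij.2).1 hd with ⟨h, -⟩ | ⟨-, h3⟩ | ⟨h, -⟩
            · omega
            · rw [hki, hσκ, hthree_neg] at h3
              rw [Prod.mk_sub_mk, hfwd]; omega
            · omega
          · intro h
            obtain ⟨hpq, h3⟩ := mem_filter.1 h
            obtain ⟨hp, hq⟩ := mem_product.1 hpq
            obtain ⟨i, hki, rfl⟩ := (hmemX κ p).1 hp
            obtain ⟨j, hkj, rfl⟩ := (hmemX (κ + 1) q).1 hq
            rw [Prod.mk_sub_mk, hfwd] at h3
            have hne : i ≠ j := by rintro rfl; omega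
            have hd : dist (x i) (x j) = 1 := by
              refine (hshell i j).2 (Or.inr (Or.inl ⟨by rw [hki, hkj], ?_⟩))
              rw [hki, hσκ, hthree_neg]; omega
            exact mem_image.2 ⟨(i, j), mem_filter.2 ⟨mem_filter.2
              ⟨mem_filter.2 ⟨mem_univ _, hne, hd⟩, show k j = k i + 1 by rw [hki, hkj]⟩, hki⟩,
              rfl⟩
        rw [← himg, card_image_of_injOn hinj1]
      · -- letter `-1`: backward pairs
        rw [if_neg (by omega)]
        have himg : (Pup.filter fun p => k p.1 = κ).image
            (fun p : Fin N × Fin N => ((a p.2, b p.2), (a p.1, b p.1))) =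
            (X (κ + 1) ×ˢ X κ).filter fun pq : (ℤ × ℤ) × (ℤ × ℤ) =>
              pq.2 - pq.1 ∈ ({(0, 0), (-1, 0), (0, -1)} : Finset (ℤ × ℤ)) := by
          ext pq
          obtain ⟨q, p⟩ := pq
          constructor
          · intro h
            obtain ⟨ij, hij, hpq⟩ := mem_image.1 h
            obtain ⟨hPup', hki⟩ := mem_filter.1 hij
            obtain ⟨hP', hkk⟩ := mem_filter.1 hPup'
            obtain ⟨-, hne, hd⟩ := mem_filter.1 hP'
            simp only [Prod.mk.injEq] at hpq
            obtain ⟨rfl, rfl⟩ := hpq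
            refine mem_filter.2 ⟨mem_product.2 ⟨(hmemX (κ + 1) _).2 ⟨ij.2, by omega, rfl⟩,
              (hmemX κ _).2 ⟨ij.1, hki, rfl⟩⟩, ?_⟩
            rcases (hshell ij.1 ij.2).1 hd with ⟨h, -⟩ | ⟨-, h3⟩ | ⟨h, -⟩
            · omega
            · rw [hki, hσκ, neg_neg, hthree_pos] at h3
              rw [Prod.mk_sub_mk, hfwd]; omega
            · omega
          · intro h
            obtain ⟨hpq, h3⟩ := mem_filter.1 h
            obtain ⟨hq, hp⟩ := mem_product.1 hpq
            obtain ⟨j, hkj, rfl⟩ := (hmemX (κ + 1) q).1 hq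
            obtain ⟨i, hki, rfl⟩ := (hmemX κ p).1 hp
            rw [Prod.mk_sub_mk, hfwd] at h3
            have hne : i ≠ j := by rintro rfl; omega
            have hd : dist (x i) (x j) = 1 := by
              refine (hshell i j).2 (Or.inr (Or.inl ⟨by rw [hki, hkj], ?_⟩))
              rw [hki, hσκ, neg_neg, hthree_pos]; omega
            exact mem_image.2 ⟨(i, j), mem_filter.2 ⟨mem_filter.2
              ⟨mem_filter.2 ⟨mem_univ _, hne, hd⟩, show k j = k i + 1 by rw [hki, hkj]⟩, hki⟩,
              rfl⟩
        rw [← himg, card_image_of_injOn hinj2]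
    -- assemble
    have hin2 : Pin.card = 2 * ∑ κ ∈ K, ((X κ ×ˢ X κ).filter fun pq : (ℤ × ℤ) × (ℤ × ℤ) =>
        pq.2 - pq.1 ∈ ({(1, 0), (0, 1), (-1, 1)} : Finset (ℤ × ℤ))).card := by
      rw [hPin_sum, mul_sum]
      exact sum_congr rfl fun κ _ => by rw [hin κ, card_filter_sub_mem_sixOffsets]
    have hup2 : Pup.card = ∑ κ ∈ K, (if σ κ = 1 then
          ((X κ ×ˢ X (κ + 1)).filter fun pq : (ℤ × ℤ) × (ℤ × ℤ) =>
            pq.2 - pq.1 ∈ ({(0, 0), (-1, 0), (0, -1)} : Finset (ℤ × ℤ))).card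
        else
          ((X (κ + 1) ×ˢ X κ).filter fun pq : (ℤ × ℤ) × (ℤ × ℤ) =>
            pq.2 - pq.1 ∈ ({(0, 0), (-1, 0), (0, -1)} : Finset (ℤ × ℤ))).card) := by
      rw [hPup_sum]
      exact sum_congr rfl fun κ _ => hup κ
    omega

end Summit.Ventures.Crystal3D.Theorems

end
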